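import Mathlib

/-!
# Word tensors of uniform tensor trains: cut ranks and commutative image

Helper file for item `DetReprLift` (stmt-ValiantsHypothesis-5924) of route `LiftNullstellensatz`
(`Summits/ValiantsHypothesis/ValiantsHypothesis/Theses/LiftNullstellensatz.lean`).

A *uniform tensor train* (matrix product state; a homogeneous algebraic branching program all of
whose layers carry the same matrices) over a finite state type `S` consists of a start covector
`α : S → R`, one transition matrix `U a : Matrix S S R` per letter `a : τ`, and a final vector
`β : S → R`.  Its **word tensor** is `ttWord α U β w = α ⬝ (U (w 0) * ⋯ * U (w (N-1))) ⬝ β` on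
words `w : Fin N → τ`.  Two facts are proved:

* `rank_flattening_ttWord_le` — every sequential flattening of `ttWord α U β` at a cut `k + l = N`
  (Nisan's partial-coefficient matrix, in the literal form used by the items of the route) is the
  product of a `(Fin k → τ) × S` matrix and an `S × (Fin l → τ)` matrix, hence has rank `≤ #S`
  (the easy direction of Nisan's width theorem, N. Nisan, STOC 1991, Thm. 1);
* `sum_ttWord_smul_prod` — the commutative image: for letter weights `ξ : τ → A` in a commutative
  `R`-algebra `A`, `Σ_w ttWord α U β w • Π_t ξ (w t) = α ⬝ (Σ_a ξ a • U a)^N ⬝ β`.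

Everything is over an arbitrary commutative ring (`StrongRankCondition` for the rank bound).
[folklore]
-/

namespace Summit.ValiantsHypothesis.ValiantsHypothesis.Theorems

-- the single-problem summit's namespace `Summit.ValiantsHypothesis.ValiantsHypothesis` repeats
set_option linter.dupNamespace false

namespace DetReprLift

open Matrix

variable {R : Type*} [CommRing R] {S : Type*} [Fintype S] [DecidableEq S] {τ : Type*}

/-- The **word tensor of the uniform tensor train** `(α, U, β)`: the coefficient of the word
`w = w₀ ⋯ w_{N-1}` is `α ⬝ (U w₀ * ⋯ * U w_{N-1}) ⬝ β`. [folklore] -/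
def ttWord (α : S → R) (U : τ → Matrix S S R) (β : S → R) {N : ℕ} (w : Fin N → τ) : R :=
  α ⬝ᵥ ((List.ofFn fun i => U (w i)).prod *ᵥ β)

/-- Unfolding `ttWord`. [folklore] -/
theorem ttWord_apply (α : S → R) (U : τ → Matrix S S R) (β : S → R) {N : ℕ} (w : Fin N → τ) :
    ttWord α U β w = α ⬝ᵥ ((List.ofFn fun i => U (w i)).prod *ᵥ β) := rfl

/-- The matrix product along a concatenated word splits at the cut. [folklore] -/
theorem prod_ofFn_append (U : τ → Matrix S S R) {k l : ℕ} (u : Fin k → τ) (v : Fin l → τ) :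
    (List.ofFn fun t => U (Fin.append u v t)).prod =
      (List.ofFn fun i => U (u i)).prod * (List.ofFn fun j => U (v j)).prod := by
  rw [List.ofFn_comp' (Fin.append u v) U, List.ofFn_fin_append, List.map_append, List.prod_append,
    ← List.ofFn_comp', ← List.ofFn_comp']

/-- The word tensor at a concatenated word is (left covector) ⬝ (right vector). [folklore] -/
theorem ttWord_append (α : S → R) (U : τ → Matrix S S R) (β : S → R) {k l : ℕ}
    (u : Fin k → τ) (v : Fin l → τ) :
    ttWord α U β (Fin.append u v) =
      (α ᵥ* (List.ofFn fun i => U (u i)).prod) ⬝ᵥ ((List.ofFn fun j => U (v j)).prod *ᵥ β) := by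
  rw [ttWord, prod_ofFn_append, ← Matrix.mulVec_mulVec, Matrix.dotProduct_mulVec]

/-- **Cut ranks of a tensor train are bounded by its width**: every sequential flattening of the
word tensor of a uniform tensor train over the state type `S` has rank `≤ #S` (Nisan 1991, Thm. 1,
easy direction: the flattening factors through `R^S`). [folklore] -/
theorem rank_flattening_ttWord_le [StrongRankCondition R] [Fintype τ]
    (α : S → R) (U : τ → Matrix S S R) (β : S → R) {N : ℕ} (k l : ℕ) (h : k + l = N) :
    (Matrix.of fun (u : Fin k → τ) (v : Fin l → τ) =>
        ttWord α U β (fun t => Fin.append u v (Fin.cast h.symm t))).rank ≤ Fintype.card S := by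
  subst h
  have hmat : (Matrix.of fun (u : Fin k → τ) (v : Fin l → τ) =>
      ttWord α U β (fun t => Fin.append u v (Fin.cast rfl t))) =
      (Matrix.of fun (u : Fin k → τ) (x : S) => (α ᵥ* (List.ofFn fun i => U (u i)).prod) x) *
        (Matrix.of fun (x : S) (v : Fin l → τ) => ((List.ofFn fun j => U (v j)).prod *ᵥ β) x) := by
    ext u v
    have happ : (fun t => Fin.append u v (Fin.cast rfl t)) = Fin.append u v := rfl
    rw [Matrix.of_apply, happ, ttWord_append, Matrix.mul_apply]
    rfl
  rw [hmat]
  exact (Matrix.rank_mul_le_left _ _).trans (Matrix.rank_le_card_width _)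

/-- The ordered product identity behind the commutative image of a tensor train:
`Σ_{w : Fin N → τ} (Π_t ξ (w t)) • (V (w 0) * ⋯ * V (w (N-1))) = (Σ_a ξ a • V a) ^ N` for matrices
`V a` over a commutative ring `A` (noncommutative expansion of a power of a sum). [folklore] -/
theorem sum_prod_smul_prod_ofFn {A : Type*} [CommRing A] [Fintype τ]
    (V : τ → Matrix S S A) (ξ : τ → A) (N : ℕ) :
    (∑ w : Fin N → τ, (∏ t, ξ (w t)) • (List.ofFn fun i => V (w i)).prod) =
      (∑ a, ξ a • V a) ^ N := by
  classical
  induction N with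
  | zero =>
    simp
  | succ N ih =>
    rw [pow_succ', ← ih, Finset.sum_mul]
    rw [← (Fin.consEquiv fun _ => τ).sum_comp, Fintype.sum_prod_type]
    refine Finset.sum_congr rfl fun a _ => ?_
    rw [Finset.mul_sum]
    refine Finset.sum_congr rfl fun w _ => ?_
    simp only [Fin.consEquiv_apply, Fin.prod_univ_succ, Fin.cons_zero, Fin.cons_succ,
      List.ofFn_succ, List.prod_cons]
    rw [smul_mul_smul_comm]

/-- **Commutative image of a tensor train**: for letter weights `ξ : τ → A` in a commutative
`R`-algebra `A`, `Σ_w ttWord α U β w • Π_t ξ (w t) = α ⬝ ((Σ_a ξ a • U a) ^ N) ⬝ β`, the entries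
of `α`, `U a`, `β` being mapped into `A`. (With `ξ = X` this is the abelianisation of the
noncommutative polynomial computed by the train.) [folklore] -/
theorem sum_ttWord_smul_prod {A : Type*} [CommRing A] [Algebra R A] [Fintype τ]
    (α : S → R) (U : τ → Matrix S S R) (β : S → R) (ξ : τ → A) (N : ℕ) :
    (∑ w : Fin N → τ, ttWord α U β w • ∏ t, ξ (w t)) =
      (algebraMap R A ∘ α) ⬝ᵥ
        ((∑ a, ξ a • (U a).map (algebraMap R A)) ^ N *ᵥ (algebraMap R A ∘ β)) := by
  classical
  have hw : ∀ w : Fin N → τ, ttWord α U β w • ∏ t, ξ (w t) =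
      (algebraMap R A ∘ α) ⬝ᵥ ((((∏ t, ξ (w t)) •
        (List.ofFn fun i => (U (w i)).map (algebraMap R A)).prod)) *ᵥ (algebraMap R A ∘ β)) := by
    intro w
    have hP : ((List.ofFn fun i => U (w i)).prod).map (algebraMap R A) =
        (List.ofFn fun i => (U (w i)).map (algebraMap R A)).prod := by
      change (algebraMap R A).mapMatrix (List.ofFn fun i => U (w i)).prod = _
      rw [map_list_prod, List.map_ofFn]
      rfl
    have hv : (algebraMap R A) ∘ ((List.ofFn fun i => U (w i)).prod *ᵥ β) =
        (List.ofFn fun i => (U (w i)).map (algebraMap R A)).prod *ᵥ (algebraMap R A ∘ β) := by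
      funext x
      rw [Function.comp_apply, RingHom.map_mulVec, hP]
    rw [Algebra.smul_def, ttWord_apply, RingHom.map_dotProduct, Matrix.smul_mulVec,
      dotProduct_smul, smul_eq_mul, mul_comm, hv]
  have key := sum_prod_smul_prod_ofFn (fun a => (U a).map (algebraMap R A)) ξ N
  beta_reduce at key
  simp_rw [hw]
  rw [← dotProduct_sum, ← Matrix.sum_mulVec, key]

end DetReprLift

end Summit.ValiantsHypothesis.ValiantsHypothesis.Theorems
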